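import Mathlib
import Literature.Computability.AlgebraicComplexity.ArithCircuitProofs
import Literature.Computability.AlgebraicComplexity.IMMInVPProofs
import Summits.ValiantsHypothesis.ValiantsHypothesis.Theorems.DivisionGapTriangularDimersDivisionEasyDefs
import Summits.ValiantsHypothesis.ValiantsHypothesis.Theorems.DivisionGapTriangularDimersDivisionEasyStubShufflingDivisionAux1

/-!
# Crux `DivisionGap.TriangularDimersDivisionEasy` (stmt-ValiantsHypothesis-5067), line `diagonal-spider-shuffling` —
registered stub `stub_shufflingDivision`

SHUFFLING GIVES DIVISION: a chain of positive local rounds `G_{m+1} → G_m` (each a subtraction-free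
reweighting `x_i ↦ N_i / D_i` of the oriented edge variables by SMALL polynomials, with small transfer
factors, `IsPositiveRound`) gives, for every `m`, a non-zero `h ∈ ℝ≥0[x]` with
`L₊(pm (E m) · h) + L₊(h) ≤ (m + C) ^ C`, i.e. polynomial monotone complexity WITH ONE DIVISION for the
matching polynomials of the chain (the normal form `f · h = g` of Hrubeš–Yehudayoff 2021 §6;
Fomin–Grigoriev–Koshevoy 2014 §1 for the additivity of subtraction-free straight-line programmes
under composition).

## Proof (ADDITIVE composition in bihomogeneous normal form)

For each level `m` we maintain (`Division.normalForm_all`) polynomials `P, Q ∈ ℝ≥0[n, d]` in doubled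
variables (a numerator `n_i` and a denominator `d_i` per oriented edge variable) with
`Q ≠ 0`, `PMH(E m) * Q = P * ∏_{edges} d_i` where `PMH(E) = pmSubst E n d = pm E (n/d) · ∏_{edges} d`,
and `L₊(P) + L₊(Q) ≤ S₀ + 43 · m · (m + B + 1) ^ (4 (2B + 1))`:

* `m = 0` (`Division.normalForm_base`): `P = PMH(E 0)`, `Q = ∏ d` — a constant-size object;
* `m → m + 1` (`Division.round_identity`, `Division.round_step`): the round identity
  `pm E' * ∏ Ld = ∏ Ln * pmSubst E N D` is pushed through `x' ↦ n'/d'` in the fraction field of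
  `ℝ[n', d']` with the common denominator `𝔻 = (∏ d') ^ B` of all small items (helper file 1,
  `Division.theta_num` & co.), giving a POLYNOMIAL identity, and the level-`m` normal form is then
  substituted POLYNOMIALLY (`n_i ↦ num (N i)`, `d_i ↦ num (D i)`); by the substitution bound
  `L(f(g)) ≤ L(f) + Σ L(gᵢ)` the cost of the round is ADDED (`+ 43 W⁴`, `W = (m + B + 1) ^ (2B + 1)`),
  never multiplied;
* end (`stub_shufflingDivision`): specialise `n ↦ x`, `d ↦ 1` (free), so `pm (E m) * Q(x, 1) = P(x, 1)`
  with `h = Q(x, 1) ≠ 0` by positivity at the all-ones point, and absorb the bound into `(m + C) ^ C`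
  with `C = S₀ + 8 B + 50` (`Division.final_bound`).

The family `(B, sz, E)` and its cofinality are passed through unchanged.  No `def` is declared.
-/

-- `Summit.ValiantsHypothesis.ValiantsHypothesis.…` is the tree's mandated single-conjunct layout (Sub = Summit).
set_option linter.dupNamespace false

namespace Summit.ValiantsHypothesis.ValiantsHypothesis.Theorems.TriangularDimersDivisionEasy.Shuffling

open scoped BigOperators NNReal
open Finset MvPolynomial Literature.Computability.AlgebraicComplexity

noncomputable section

namespace Division
/-! ### Helper lemmas for `stub_shufflingDivision` (this stub's private namespace), part 2 -/

/-- THE ROUND IDENTITY IN NORMAL FORM: pushing a positive round through `x' ↦ n'/d'` and clearing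
denominators gives the polynomial identity
`PMH(E') * ∏ (Ld.map num) * 𝔻 ^ (|Ln| + #edges E) = (∏_{edges E'} d') * ∏ (Ln.map num) * 𝔻 ^ |Ld| * pmSubst E (num ∘ N) (num ∘ D)`
in `ℝ≥0[n', d']` (proved in the fraction field of `ℝ[n', d']` and pulled back along the injection).
[folklore] -/
theorem round_identity {k k' B : ℕ} (E' : Fin k' → Fin k' → Bool) (E : Fin k → Fin k → Bool)
    (N D : Fin k × Fin k → MvPolynomial (Fin k' × Fin k') ℝ≥0)
    (Ln Ld : List (MvPolynomial (Fin k' × Fin k') ℝ≥0))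
    (hN : ∀ i, (N i).totalDegree ≤ B) (hD : ∀ i, (D i).totalDegree ≤ B)
    (hLn : ∀ p ∈ Ln, p.totalDegree ≤ B) (hLd : ∀ p ∈ Ld, p.totalDegree ≤ B)
    (hR : pm E' * Ld.prod = Ln.prod * pmSubst E N D)
    (num : MvPolynomial (Fin k' × Fin k') ℝ≥0 →
      MvPolynomial ((Fin k' × Fin k') ⊕ (Fin k' × Fin k')) ℝ≥0)
    (hnum : ∀ s, num s = ∑ α ∈ s.support, C (coeff α s) *
      ∏ j, ((X (Sum.inl j) : MvPolynomial ((Fin k' × Fin k') ⊕ (Fin k' × Fin k')) ℝ≥0) ^ (α j) *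
        X (Sum.inr j) ^ (B - α j)))
    (𝔻 : MvPolynomial ((Fin k' × Fin k') ⊕ (Fin k' × Fin k')) ℝ≥0)
    (h𝔻 : 𝔻 = (∏ j, (X (Sum.inr j) : MvPolynomial ((Fin k' × Fin k') ⊕ (Fin k' × Fin k')) ℝ≥0)) ^ B) :
    pmSubst E' (fun j => X (Sum.inl j)) (fun j => X (Sum.inr j)) * (Ld.map num).prod *
        𝔻 ^ (Ln.length + (univ.filter (fun i : Fin k × Fin k => E i.1 i.2 = true)).card) =
      (∏ j ∈ univ.filter (fun j : Fin k' × Fin k' => E' j.1 j.2 = true), X (Sum.inr j)) *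
        (Ln.map num).prod * 𝔻 ^ Ld.length * pmSubst E (fun i => num (N i)) (fun i => num (D i)) := by
  let R' := MvPolynomial ((Fin k' × Fin k') ⊕ (Fin k' × Fin k')) ℝ
  let K := FractionRing R'
  let ι : MvPolynomial ((Fin k' × Fin k') ⊕ (Fin k' × Fin k')) ℝ≥0 →+* K :=
    (algebraMap R' K).comp (MvPolynomial.map NNReal.toRealHom)
  have hinj : Function.Injective ι :=
    (IsFractionRing.injective R' K).comp (map_injective NNReal.toRealHom NNReal.coe_injective)
  have hι : ∀ j, ι (X (Sum.inr j)) ≠ 0 := fun j h =>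
    X_ne_zero (R := ℝ≥0) (Sum.inr j) (hinj (h.trans (map_zero ι).symm))
  let θ : MvPolynomial (Fin k' × Fin k') ℝ≥0 →+* K :=
    eval₂Hom (ι.comp C) (fun j => ι (X (Sum.inl j)) / ι (X (Sum.inr j)))
  have hθC : ∀ c, θ (C c) = ι (C c) := fun c => eval₂Hom_C _ _ c
  have hθX : ∀ j, θ (X j) = ι (X (Sum.inl j)) / ι (X (Sum.inr j)) := fun j => eval₂Hom_X' _ _ j
  have hθR := congrArg θ hR
  rw [map_mul, map_mul] at hθR
  have ha := theta_pm_mul ι θ hθX hι E'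
  have hbn := theta_list_prod B num hnum 𝔻 h𝔻 ι θ hθC hθX hι Ln hLn
  have hbd := theta_list_prod B num hnum 𝔻 h𝔻 ι θ hθC hθX hι Ld hLd
  have hc := theta_pmSubst_mul B num hnum 𝔻 h𝔻 ι θ hθC hθX hι E N D hN hD
  apply hinj
  simp only [map_mul, map_pow]
  rw [← ha, ← hbn, ← hbd, ← hc]
  linear_combination (ι (∏ j ∈ univ.filter (fun j : Fin k' × Fin k' => E' j.1 j.2 = true),
    X (Sum.inr j)) * ι 𝔻 ^ Ld.length * ι 𝔻 ^ (Ln.length +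
      (univ.filter (fun i : Fin k × Fin k => E i.1 i.2 = true)).card)) * hθR

/-- ONE ROUND, ADDITIVELY: from the level-`m` normal form (`Q ≠ 0`, `PMH(E) * Q = P * ∏_{edges E} d`,
`L₊(P) + L₊(Q) ≤ S`) and a positive round `E' → E` with constant `B` and `≤ M` transfer factors,
the level-`m+1` normal form with `L₊(P') + L₊(Q') ≤ S + 43 W⁴` for any `W ≥ 1` bounding
`k², k'², M, B`: `Q' = ∏ (Ld.map num) * 𝔻 ^ (|Ln| + #edges E) * Q(num N, num D)`,
`P' = ∏ (Ln.map num) * 𝔻 ^ |Ld| * P(num N, num D) * ∏_{edges E} num (D i)`, by `round_identity`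
and the substitution bound `L(f(g)) ≤ L(f) + Σ L(gᵢ)`. [cite: Burgisser2000, Rem. 2.7] -/
theorem round_step {B M k k' S W : ℕ} (E' : Fin k' → Fin k' → Bool) (E : Fin k → Fin k → Bool)
    (hR : IsPositiveRound B M E' E)
    (hIH : ∃ P Q : MvPolynomial ((Fin k × Fin k) ⊕ (Fin k × Fin k)) ℝ≥0, Q ≠ 0 ∧
      pmSubst E (fun i => X (Sum.inl i)) (fun i => X (Sum.inr i)) * Q =
        P * ∏ i ∈ univ.filter (fun i : Fin k × Fin k => E i.1 i.2 = true), X (Sum.inr i) ∧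
      complexity P + complexity Q ≤ S)
    (hk : k * k ≤ W) (hk' : k' * k' ≤ W) (hM : M ≤ W) (hB : B ≤ W) (hW : 1 ≤ W) :
    ∃ P' Q' : MvPolynomial ((Fin k' × Fin k') ⊕ (Fin k' × Fin k')) ℝ≥0, Q' ≠ 0 ∧
      pmSubst E' (fun i => X (Sum.inl i)) (fun i => X (Sum.inr i)) * Q' =
        P' * ∏ i ∈ univ.filter (fun i : Fin k' × Fin k' => E' i.1 i.2 = true), X (Sum.inr i) ∧
      complexity P' + complexity Q' ≤ S + 43 * W ^ 4 := by
  obtain ⟨N, D, Ln, Ld, hND, hL, hlen, hRid⟩ := hR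
  obtain ⟨P, Q, hQ, hid, hc⟩ := hIH
  obtain ⟨num, hnum⟩ : ∃ num : MvPolynomial (Fin k' × Fin k') ℝ≥0 →
      MvPolynomial ((Fin k' × Fin k') ⊕ (Fin k' × Fin k')) ℝ≥0, ∀ s, num s =
        ∑ α ∈ s.support, C (coeff α s) *
          ∏ j, ((X (Sum.inl j) : MvPolynomial ((Fin k' × Fin k') ⊕ (Fin k' × Fin k')) ℝ≥0) ^ (α j) *
            X (Sum.inr j) ^ (B - α j)) := ⟨_, fun _ => rfl⟩
  obtain ⟨𝔻, h𝔻⟩ : ∃ 𝔻 : MvPolynomial ((Fin k' × Fin k') ⊕ (Fin k' × Fin k')) ℝ≥0,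
      𝔻 = (∏ j, (X (Sum.inr j) : MvPolynomial ((Fin k' × Fin k') ⊕ (Fin k' × Fin k')) ℝ≥0)) ^ B :=
    ⟨_, rfl⟩
  set eE := univ.filter (fun i : Fin k × Fin k => E i.1 i.2 = true)
  set ψ := aeval (R := ℝ≥0) (Sum.elim (fun i => num (N i)) (fun i => num (D i))) with hψ
  have hLn : ∀ p ∈ Ln, IsSmall B p := fun p hp => hL p (List.mem_append_left _ hp)
  have hLd : ∀ p ∈ Ld, IsSmall B p := fun p hp => hL p (List.mem_append_right _ hp)
  -- the identity
  have hR' := round_identity E' E N D Ln Ld (fun i => (hND i).1.2.1) (fun i => (hND i).2.2.1)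
    (fun p hp => (hLn p hp).2.1) (fun p hp => (hLd p hp).2.1) hRid num hnum 𝔻 h𝔻
  have hψid : pmSubst E (fun i => num (N i)) (fun i => num (D i)) * ψ Q =
      ψ P * ∏ i ∈ eE, num (D i) := by
    have h := congrArg ψ hid
    rw [map_mul, map_mul, map_prod, hψ, aeval_pmSubst_X] at h
    simpa only [aeval_X, Sum.elim_inr] using h
  refine ⟨(Ln.map num).prod * 𝔻 ^ Ld.length * ψ P * ∏ i ∈ eE, num (D i),
    (Ld.map num).prod * 𝔻 ^ (Ln.length + eE.card) * ψ Q, ?_, ?_, ?_⟩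
  · -- non-vanishing
    refine mul_ne_zero (mul_ne_zero ?_ (pow_ne_zero _ (den_ne_zero B 𝔻 h𝔻))) ?_
    · refine list_prod_ne_zero _ fun p hp => ?_
      obtain ⟨q, hq, rfl⟩ := List.mem_map.mp hp
      exact num_ne_zero B num hnum q (hLd q hq).1
    · refine aeval_ne_zero Q _ hQ fun i => ?_
      cases i with
      | inl i => exact num_ne_zero B num hnum _ (hND i).1.1
      | inr i => exact num_ne_zero B num hnum _ (hND i).2.1
  · -- the normal form at level m+1
    calc pmSubst E' (fun i => X (Sum.inl i)) (fun i => X (Sum.inr i)) *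
          ((Ld.map num).prod * 𝔻 ^ (Ln.length + eE.card) * ψ Q)
        = pmSubst E' (fun i => X (Sum.inl i)) (fun i => X (Sum.inr i)) * (Ld.map num).prod *
            𝔻 ^ (Ln.length + eE.card) * ψ Q := by ring
      _ = (∏ j ∈ univ.filter (fun j : Fin k' × Fin k' => E' j.1 j.2 = true), X (Sum.inr j)) *
            (Ln.map num).prod * 𝔻 ^ Ld.length *
            (pmSubst E (fun i => num (N i)) (fun i => num (D i)) * ψ Q) := by
          rw [hR']; ring
      _ = _ := by rw [hψid]; ring
  · -- sizes
    have hcard : Fintype.card (Fin k' × Fin k') = k' * k' := by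
      rw [Fintype.card_prod, Fintype.card_fin]
    have heE' : eE.card ≤ k * k :=
      (Finset.card_filter_le _ _).trans (by rw [Finset.card_univ, Fintype.card_prod, Fintype.card_fin])
    -- item sizes
    have hν : ∀ s, IsSmall B s → complexity (num s) ≤ B * (k' * k' * (B + 2) + 2) := fun s hs => by
      simpa only [hcard] using complexity_num_le B num hnum s hs
    have hδ : complexity 𝔻 ≤ B * (k' * k' + 1) := by
      simpa only [hcard] using complexity_den_le B 𝔻 h𝔻
    have hpow : ∀ e, complexity (𝔻 ^ e) ≤ e * (B * (k' * k' + 1) + 1) := fun e =>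
      calc complexity (𝔻 ^ e) ≤ e * complexity 𝔻 + e := complexity_pow_le _ _
        _ ≤ e * (B * (k' * k' + 1)) + e := by gcongr
        _ = e * (B * (k' * k' + 1) + 1) := by ring
    have hLnc : complexity (Ln.map num).prod ≤ Ln.length * (B * (k' * k' * (B + 2) + 2) + 1) := by
      simpa only [List.length_map] using complexity_list_prod_le (Ln.map num) _
        (fun p hp => by obtain ⟨q, hq, rfl⟩ := List.mem_map.mp hp; exact hν q (hLn q hq))
    have hLdc : complexity (Ld.map num).prod ≤ Ld.length * (B * (k' * k' * (B + 2) + 2) + 1) := by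
      simpa only [List.length_map] using complexity_list_prod_le (Ld.map num) _
        (fun p hp => by obtain ⟨q, hq, rfl⟩ := List.mem_map.mp hp; exact hν q (hLd q hq))
    have hsub : ∑ i, complexity (Sum.elim (fun i => num (N i)) (fun i => num (D i)) i) ≤
        2 * (k * k) * (B * (k' * k' * (B + 2) + 2)) := by
      rw [Fintype.sum_sum_type]
      simp only [Sum.elim_inl, Sum.elim_inr]
      calc ∑ i, complexity (num (N i)) + ∑ i, complexity (num (D i))
          ≤ ∑ _i : Fin k × Fin k, B * (k' * k' * (B + 2) + 2) +
              ∑ _i : Fin k × Fin k, B * (k' * k' * (B + 2) + 2) :=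
            add_le_add (Finset.sum_le_sum fun i _ => hν _ (hND i).1)
              (Finset.sum_le_sum fun i _ => hν _ (hND i).2)
        _ = 2 * (k * k) * (B * (k' * k' * (B + 2) + 2)) := by
            rw [Finset.sum_const, smul_eq_mul, Finset.card_univ, Fintype.card_prod, Fintype.card_fin]
            ring
    have hψP : complexity (ψ P) ≤ complexity P + 2 * (k * k) * (B * (k' * k' * (B + 2) + 2)) :=
      (complexity_aeval_le _ _).trans (by gcongr)
    have hψQ : complexity (ψ Q) ≤ complexity Q + 2 * (k * k) * (B * (k' * k' * (B + 2) + 2)) :=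
      (complexity_aeval_le _ _).trans (by gcongr)
    have hPD : complexity (∏ i ∈ eE, num (D i)) ≤ k * k * (B * (k' * k' * (B + 2) + 2) + 1) := by
      refine (complexity_finset_prod_le _ _).trans ?_
      calc ∑ i ∈ eE, complexity (num (D i)) + eE.card
          ≤ ∑ _i ∈ eE, B * (k' * k' * (B + 2) + 2) + eE.card :=
            Nat.add_le_add_right (Finset.sum_le_sum fun i _ => hν _ (hND i).2) _
        _ = eE.card * (B * (k' * k' * (B + 2) + 2) + 1) := by
            rw [Finset.sum_const, smul_eq_mul]; ring
        _ ≤ k * k * (B * (k' * k' * (B + 2) + 2) + 1) := by gcongr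
    have hmul3 : ∀ a b c : MvPolynomial ((Fin k' × Fin k') ⊕ (Fin k' × Fin k')) ℝ≥0,
        complexity (a * b * c) ≤ complexity a + complexity b + complexity c + 2 := fun a b c =>
      calc complexity (a * b * c) ≤ complexity (a * b) + complexity c + 1 := complexity_mul_le_holds _ _
        _ ≤ (complexity a + complexity b + 1) + complexity c + 1 := by
            gcongr; exact complexity_mul_le_holds _ _
        _ = _ := by ring
    have hmul4 : ∀ a b c d : MvPolynomial ((Fin k' × Fin k') ⊕ (Fin k' × Fin k')) ℝ≥0,
        complexity (a * b * c * d) ≤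
          complexity a + complexity b + complexity c + complexity d + 3 := fun a b c d =>
      calc complexity (a * b * c * d) ≤ complexity (a * b * c) + complexity d + 1 :=
            complexity_mul_le_holds _ _
        _ ≤ (complexity a + complexity b + complexity c + 2) + complexity d + 1 := by
            gcongr; exact hmul3 _ _ _
        _ = _ := by ring
    set ν := B * (k' * k' * (B + 2) + 2) with hνdef
    set δ := B * (k' * k' + 1) with hδdef
    have hP' : complexity ((Ln.map num).prod * 𝔻 ^ Ld.length * ψ P * ∏ i ∈ eE, num (D i)) ≤
        Ln.length * (ν + 1) + Ld.length * (δ + 1) + (complexity P + 2 * (k * k) * ν) +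
          k * k * (ν + 1) + 3 :=
      (hmul4 _ _ _ _).trans
        (add_le_add (add_le_add (add_le_add (add_le_add hLnc (hpow _)) hψP) hPD) le_rfl)
    have hQ' : complexity ((Ld.map num).prod * 𝔻 ^ (Ln.length + eE.card) * ψ Q) ≤
        Ld.length * (ν + 1) + (Ln.length + eE.card) * (δ + 1) +
          (complexity Q + 2 * (k * k) * ν) + 2 :=
      (hmul3 _ _ _).trans (add_le_add (add_le_add (add_le_add hLdc (hpow _)) hψQ) le_rfl)
    have hLW : Ln.length + Ld.length ≤ W := hlen.trans hM
    have heW : eE.card ≤ W := heE'.trans hk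
    have hνW : ν ≤ W * (W * (W + 2) + 2) := by rw [hνdef]; gcongr
    have hδW : δ ≤ W * (W + 1) := by rw [hδdef]; gcongr
    have h1 : W ≤ W ^ 4 := Nat.le_self_pow (by norm_num) W
    have h2 : W ^ 2 ≤ W ^ 4 := Nat.pow_le_pow_right hW (by norm_num)
    have h3 : W ^ 3 ≤ W ^ 4 := Nat.pow_le_pow_right hW (by norm_num)
    have h0 : 1 ≤ W ^ 4 := Nat.one_le_pow _ _ hW
    calc _ ≤ _ := add_le_add hP' hQ'
      _ = (complexity P + complexity Q) + ((Ln.length + Ld.length) * (ν + 1) +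
            (Ln.length + Ld.length + eE.card) * (δ + 1) + 4 * (k * k) * ν + k * k * (ν + 1) + 5) := by
          ring
      _ ≤ S + (W * (W * (W * (W + 2) + 2) + 1) + (W + W) * (W * (W + 1) + 1) +
            4 * W * (W * (W * (W + 2) + 2)) + W * (W * (W * (W + 2) + 2) + 1) + 5) := by
          gcongr
      _ ≤ S + 43 * W ^ 4 := by nlinarith [h0, h1, h2, h3]

/-- BASE of the composition: at level `0` the normal form `PMH * (∏ d) = PMH * ∏ d` with the crude
size bound `k ^ k (k + k² + 2) + k²`, `k = sz 0`. [folklore] -/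
theorem normalForm_base {k : ℕ} (E : Fin k → Fin k → Bool) :
    ∃ P Q : MvPolynomial ((Fin k × Fin k) ⊕ (Fin k × Fin k)) ℝ≥0, Q ≠ 0 ∧
      pmSubst E (fun i => X (Sum.inl i)) (fun i => X (Sum.inr i)) * Q =
        P * ∏ i ∈ univ.filter (fun i : Fin k × Fin k => E i.1 i.2 = true), X (Sum.inr i) ∧
      complexity P + complexity Q ≤ k ^ k * (k + k * k + 2) + k * k := by
  refine ⟨_, _, Finset.prod_ne_zero_iff.mpr fun i _ => X_ne_zero _, rfl, ?_⟩
  refine add_le_add (complexity_pmSubst_X_le E) ((complexity_prod_X_le _ _).trans ?_)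
  exact (Finset.card_filter_le _ _).trans
    (by rw [Finset.card_univ, Fintype.card_prod, Fintype.card_fin])

/-- ALL LEVELS, ADDITIVELY: the bihomogeneous normal form `PMH(E m) * Q = P * ∏ d`, `Q ≠ 0`, with
`L₊(P) + L₊(Q) ≤ S₀ + 43 · m · ((m + B + 1) ^ (2B + 1)) ^ 4` — induction up the chain of rounds by
`round_step` (Hrubeš–Yehudayoff 2021 §6 normal form; Fomin–Grigoriev–Koshevoy 2014 §1).
[cite: Burgisser2000, Rem. 2.7] -/
theorem normalForm_all {B : ℕ} {sz : ℕ → ℕ} (E : ∀ m, Fin (sz m) → Fin (sz m) → Bool)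
    (hsz : ∀ m, sz m ≤ (m + B) ^ B)
    (hround : ∀ m, IsPositiveRound B ((m + B) ^ B) (E (m + 1)) (E m)) (m : ℕ) :
    ∃ P Q : MvPolynomial ((Fin (sz m) × Fin (sz m)) ⊕ (Fin (sz m) × Fin (sz m))) ℝ≥0, Q ≠ 0 ∧
      pmSubst (E m) (fun i => X (Sum.inl i)) (fun i => X (Sum.inr i)) * Q =
        P * ∏ i ∈ univ.filter (fun i : Fin (sz m) × Fin (sz m) => E m i.1 i.2 = true),
          X (Sum.inr i) ∧
      complexity P + complexity Q ≤
        (sz 0 ^ sz 0 * (sz 0 + sz 0 * sz 0 + 2) + sz 0 * sz 0) +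
          43 * m * ((m + B + 1) ^ (2 * B + 1)) ^ 4 := by
  induction m with
  | zero => simpa only [mul_zero, zero_mul, add_zero] using normalForm_base (E 0)
  | succ m ih =>
    have hb1 : 1 ≤ m + B + 1 := by omega
    have hW : 1 ≤ (m + B + 1) ^ (2 * B + 1) := Nat.one_le_pow _ _ (by omega)
    have hsq : ∀ a, a ≤ (m + B + 1) ^ B → a * a ≤ (m + B + 1) ^ (2 * B + 1) := fun a h =>
      calc a * a ≤ (m + B + 1) ^ B * (m + B + 1) ^ B := Nat.mul_le_mul h h
        _ = (m + B + 1) ^ (2 * B) := by rw [← pow_add, two_mul]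
        _ ≤ (m + B + 1) ^ (2 * B + 1) := Nat.pow_le_pow_right hb1 (by omega)
    have hk : sz m * sz m ≤ (m + B + 1) ^ (2 * B + 1) :=
      hsq _ ((hsz m).trans (Nat.pow_le_pow_left (by omega) _))
    have hk' : sz (m + 1) * sz (m + 1) ≤ (m + B + 1) ^ (2 * B + 1) := by
      refine hsq _ ?_
      have h := hsz (m + 1)
      rwa [show m + 1 + B = m + B + 1 by omega] at h
    have hM : (m + B) ^ B ≤ (m + B + 1) ^ (2 * B + 1) :=
      (Nat.pow_le_pow_left (by omega) _).trans (Nat.pow_le_pow_right hb1 (by omega))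
    have hB : B ≤ (m + B + 1) ^ (2 * B + 1) :=
      (by omega : B ≤ m + B + 1).trans (Nat.le_self_pow (by omega) _)
    obtain ⟨P', Q', h1, h2, h3⟩ := round_step (E (m + 1)) (E m) (hround m) ih hk hk' hM hB hW
    refine ⟨P', Q', h1, h2, h3.trans ?_⟩
    have hmono : ((m + B + 1) ^ (2 * B + 1)) ^ 4 ≤ ((m + 1 + B + 1) ^ (2 * B + 1)) ^ 4 :=
      Nat.pow_le_pow_left (Nat.pow_le_pow_left (by omega) _) _
    calc _ = (sz 0 ^ sz 0 * (sz 0 + sz 0 * sz 0 + 2) + sz 0 * sz 0) +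
          43 * (m + 1) * ((m + B + 1) ^ (2 * B + 1)) ^ 4 := by ring
      _ ≤ _ := by gcongr

/-- Polynomial growth bookkeeping: `S₀ + 43 m (m + B + 1) ^ (4 (2B + 1)) ≤ (m + C) ^ C` for
`C = S₀ + 8 B + 50`. [folklore] -/
theorem final_bound (S₀ B m : ℕ) :
    S₀ + 43 * m * ((m + B + 1) ^ (2 * B + 1)) ^ 4 ≤ (m + (S₀ + 8 * B + 50)) ^ (S₀ + 8 * B + 50) := by
  set C := S₀ + 8 * B + 50 with hC
  have hX : 2 ≤ m + C := by omega
  have h1 : S₀ ≤ m + C := by omega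
  have h2 : 43 * m * ((m + B + 1) ^ (2 * B + 1)) ^ 4 ≤ (m + C) ^ (8 * B + 6) := by
    rw [← pow_mul, show 8 * B + 6 = 1 + 1 + (2 * B + 1) * 4 by ring, pow_add, pow_add, pow_one]
    exact Nat.mul_le_mul (Nat.mul_le_mul (by omega) (by omega)) (Nat.pow_le_pow_left (by omega) _)
  have h3 : m + C ≤ (m + C) ^ (8 * B + 6) := Nat.le_self_pow (by omega) _
  calc S₀ + 43 * m * ((m + B + 1) ^ (2 * B + 1)) ^ 4 ≤ (m + C) + (m + C) ^ (8 * B + 6) :=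
        add_le_add h1 h2
    _ ≤ (m + C) ^ (8 * B + 6) + (m + C) ^ (8 * B + 6) := Nat.add_le_add_right h3 _
    _ = (m + C) ^ (8 * B + 6) * 2 := by ring
    _ ≤ (m + C) ^ (8 * B + 6) * (m + C) := Nat.mul_le_mul_left _ hX
    _ = (m + C) ^ (8 * B + 7) := by rw [← pow_succ]
    _ ≤ (m + C) ^ C := Nat.pow_le_pow_right (by omega) (by omega)

end Division

open Division in
/-- **Registered stub `stub_shufflingDivision`** (crux stmt-ValiantsHypothesis-5067, line `diagonal-spider-shuffling`).
SHUFFLING GIVES DIVISION: from a positive shuffling — a graph family `(E m on Fin (sz m))_m` of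
polynomial size, a positive local round `E (m+1) → E m` with constant `B` and `≤ (m + B) ^ B` transfer
factors for every `m`, and cofinality for the even rhombi — the SAME family satisfies, for some `C`
and every `m`, the division normal form: a non-zero `h ∈ ℝ≥0[x]` with
`L₊(pm (E m) · h) + L₊(h) ≤ (m + C) ^ C`.  Proof: compose the rounds ADDITIVELY in the bihomogeneous
normal form `PMH * Q = P * ∏ d` (`Division.normalForm_all`), then specialise `n ↦ x`, `d ↦ 1`
(free substitution) and take `h = Q(x, 1)`, non-zero by positivity (Hrubeš–Yehudayoff 2021 §6;
Fomin–Grigoriev–Koshevoy 2014 §1; substitution bound Bürgisser 2000 Rem. 2.7).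
[cite: Burgisser2000, Rem. 2.7] -/
theorem stub_shufflingDivision
    (hS : ∃ (B : ℕ) (sz : ℕ → ℕ) (E : ∀ m, Fin (sz m) → Fin (sz m) → Bool),
      (∀ m, sz m ≤ (m + B) ^ B) ∧
      (∀ m, IsPositiveRound B ((m + B) ^ B) (E (m + 1)) (E m)) ∧
      Cofinal B sz E) :
    ∃ (B C : ℕ) (sz : ℕ → ℕ) (E : ∀ m, Fin (sz m) → Fin (sz m) → Bool),
      Cofinal B sz E ∧
      ∀ m, ∃ h : MvPolynomial (Fin (sz m) × Fin (sz m)) ℝ≥0,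
        h ≠ 0 ∧ complexity (pm (E m) * h) + complexity h ≤ (m + C) ^ C := by
  obtain ⟨B, sz, E, hsz, hround, hcof⟩ := hS
  refine ⟨B, (sz 0 ^ sz 0 * (sz 0 + sz 0 * sz 0 + 2) + sz 0 * sz 0) + 8 * B + 50, sz, E, hcof,
    fun m => ?_⟩
  obtain ⟨P, Q, hQ, hid, hc⟩ := normalForm_all E hsz hround m
  set ρ := aeval (R := ℝ≥0) (Sum.elim
    (fun i : Fin (sz m) × Fin (sz m) => (X i : MvPolynomial (Fin (sz m) × Fin (sz m)) ℝ≥0))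
    (fun _ : Fin (sz m) × Fin (sz m) => 1)) with hρ
  have hρid : pm (E m) * ρ Q = ρ P := by
    have h := congrArg ρ hid
    rw [map_mul, map_mul, map_prod, hρ, aeval_pmSubst_X, pmSubst_X_one] at h
    simpa only [aeval_X, Sum.elim_inr, Finset.prod_const_one, mul_one] using h
  have h1 : complexity (1 : MvPolynomial (Fin (sz m) × Fin (sz m)) ℝ≥0) = 0 := by
    rw [← C_1]
    exact complexity_C_holds _
  have hX0 : ∀ i, complexity (X i : MvPolynomial (Fin (sz m) × Fin (sz m)) ℝ≥0) = 0 :=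
    complexity_X_holds
  have hsum : ∑ i, complexity (Sum.elim
      (fun i : Fin (sz m) × Fin (sz m) => (X i : MvPolynomial (Fin (sz m) × Fin (sz m)) ℝ≥0))
      (fun _ : Fin (sz m) × Fin (sz m) => 1) i) = 0 := by
    rw [Fintype.sum_sum_type]
    simp only [Sum.elim_inl, Sum.elim_inr, hX0, h1, Finset.sum_const_zero, add_zero]
  refine ⟨ρ Q, aeval_ne_zero Q _ hQ (fun i => ?_), ?_⟩
  · cases i with
    | inl i => exact X_ne_zero _
    | inr i => exact one_ne_zero
  · rw [hρid]
    calc complexity (ρ P) + complexity (ρ Q) ≤ (complexity P + _) + (complexity Q + _) :=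
          add_le_add (complexity_aeval_le _ _) (complexity_aeval_le _ _)
      _ = complexity P + complexity Q := by rw [hsum, add_zero, add_zero]
      _ ≤ _ := hc
      _ ≤ _ := final_bound _ B m

end

end Summit.ValiantsHypothesis.ValiantsHypothesis.Theorems.TriangularDimersDivisionEasy.Shuffling
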